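import Literature.Computability.Cryptography.SISFunctionSolver
import Literature.Computability.Cryptography.SISFunctionProofs
import Literature.Computability.Complexity.HashBricks
import Literature.Computability.Complexity.StackBricksArith
import Literature.Computability.Complexity.FoldBricks
import HarnessLib

/-!
# The SIS′ solver is polynomial-time, I: the parameters as `FP` string functions

First brick file of the discharge of the named fact `Literature.Computability.Cryptography.sisSolver_polyTime`
(`SISFunctionSolver.lean`; the TM2-level leaf of
`Literature.Computability.Cryptography.owfExist_of_gapSVP_worstCaseHard`, cf.
`owfExist_of_gapSVP_worstCaseHard_of_two` in `LatticeOWFProofs.lean`). The explicit reduction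
`SIS.sisSolver A cb` reads the dimension `n = SIS.nOf inp` off the instance and slices its coin
string at offsets given by the parameters `guessBits n`, `width n`, `blockLen n`,
`lenBits cb n`; here these parameters are computed from the instance by total polynomial-time
string functions, in the "algebra of `FP` string functions" style of `BrickAlgebra.lean` /
`PlumbingBricks.lean` / `HashBricks.lean` (no new machine, no new transducer):

* `nU inp = 1ⁿ`, `n = SIS.nOf inp` (pair projections);
* from a unary numeral `1ⁿ` (any string of length `n`): `llU = 1^{logLen n}` (the length of the
  binary numeral of `n + 2`, `SIS.size_add_two`), `tU = 1^{bitWidth n}`, `mU = 1^{width n}`,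
  `klU = 1^{keyLen n}`, `blU = 1^{blockLen n}` (a difference of two `keyLen`s, `Plumb.dropFn`),
  `gU = 1^{guessBits n}` (`guessBits n = |encodeNat (blockLen n)|`); the binary numerals of `modulus n` and
  `width n` are the tree's `SIS.modFn` (value on all strings: `modFn_eq_encodeNat_modulus`) and `SIS.widthFn`
  (`SISFunctionProofs.lean`);
* binary arithmetic for the coin-count guess: `bpolyFn p w = encodeNat (p ⟦w⟧)` for every
  polynomial `p` (by induction on `p`, from `Brick.addFn` / `Brick.prodFn`), the bounds
  `resBoundB`, `matBoundB`, `inpBoundB = encodeNat (inpBound n)` and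
  `lbU p = 1^{lenBits (p ·) n}` (`lenBits cb n = |encodeNat (cbMax cb n + 1)|`, and
  `cbMax (p ·) n = p (inpBound n)` since polynomials are monotone, `SIS.cbMax_eq_of_monotone`).

Every function is specified on ALL strings of the stated shape (`_apply` lemmas) and is in `FP`
(`_mem_FP`). The sibling files build the key extraction `SIS.keyOf` and the run map of
`SIS.sisSolver` from these.

## References

* S. Arora, B. Barak, *Computational Complexity: A Modern Approach*, CUP 2009, §1.3 (polynomial
  time is closed under composition; arithmetic on binary numerals), §0.1 (representations).
* D. Micciancio, O. Regev, *Worst-case to average-case reductions based on Gaussian measures*,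
  SIAM J. Comput. 37 (2007), §5.1 (the reduction behind `SIS.sisSolver`).
-/

noncomputable section

namespace Literature.Computability.Cryptography.SIS.SolverFP

open _root_.Computability Polynomial Literature.Computability.Complexity Brick Plumb HashBricks OracleCompose

/-! ### Generic helpers -/

/-- `v.size = ⌊log₂ v⌋ + 1` for `v ≥ 1`. (Twin, up to its home, of
`Literature.Computability.Cryptography.LPO.size_eq_log_succ` in `LiuPassOWFProgram.lean` and of
`log_add_eq_size` in `LiuPassHeurBricks.lean`, whose program files are not imported here; librarian: hoist one
copy next to `SIS.encodeNat_length_eq_size` in `SISFunctionProofs.lean`.) [folklore] -/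
theorem size_eq_log_succ {v : ℕ} (hv : v ≠ 0) : v.size = Nat.log 2 v + 1 := by
  apply le_antisymm
  · exact Nat.size_le.2 (Nat.lt_pow_succ_log_self one_lt_two v)
  · by_contra h
    have h' : v.size ≤ Nat.log 2 v := by omega
    have := Nat.size_le.1 h'
    have := Nat.pow_log_le_self 2 hv
    omega

/-- `|encodeNat v| = ⌊log₂ v⌋ + 1` for `v ≥ 1`. [folklore] -/
theorem length_encodeNat_eq_log_succ {v : ℕ} (hv : v ≠ 0) : (encodeNat v).length = Nat.log 2 v + 1 := by
  rw [encodeNat_length_eq_size, size_eq_log_succ hv]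

/-- **Binary evaluation of a polynomial**: `bpolyFn p w = encodeNat (p ⟦w⟧)`. [cite: AroraBarakCC2009, §1.3 (arithmetic in polynomial time)] -/
def bpolyFn (p : Polynomial ℕ) (w : List Bool) : List Bool := encodeNat (p.eval (Complexity.bitsToNat w))

/-- `bpolyFn p ∈ FP` for every polynomial `p` (induction on `p`: constants, sums, and
multiplication by `X` via `Brick.prodFn`). [cite: AroraBarakCC2009, §1.3] -/
theorem bpolyFn_mem_FP (p : Polynomial ℕ) : bpolyFn p ∈ FP := by
  induction p using Polynomial.induction_on with
  | C a =>
    have : bpolyFn (C a) = fun _ => encodeNat a := by funext w; simp [bpolyFn]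
    rw [this]; exact const_mem_FP _
  | add p q hp hq =>
    have : bpolyFn (p + q) = addFn ∘ fanoutFn (bpolyFn p) (bpolyFn q) := by
      funext w; simp [bpolyFn, fanoutFn_apply, addFn_boolPair, bitsToNat_encodeNat]
    rw [this]; exact comp_mem_FP addFn_mem_FP (fanoutFn_mem_FP hp hq)
  | monomial k a h =>
    have : bpolyFn (C a * X ^ (k + 1)) = prodFn ∘ fanoutFn (bpolyFn (C a * X ^ k)) norm := by
      funext w
      simp [bpolyFn, fanoutFn_apply, prodFn_boolPair, bitsToNat_encodeNat, norm_eq_encodeNat, pow_succ, mul_assoc]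
    rw [this]; exact comp_mem_FP prodFn_mem_FP (fanoutFn_mem_FP h norm_mem_FP)


/-- Binary sum of two string functions: `⟦baddFn f g w⟧ = ⟦f w⟧ + ⟦g w⟧`. [folklore] -/
def baddFn (f g : List Bool → List Bool) : List Bool → List Bool := addFn ∘ fanoutFn f g

/-- Binary product of two string functions: `⟦bmulFn f g w⟧ = ⟦f w⟧ · ⟦g w⟧`. [folklore] -/
def bmulFn (f g : List Bool → List Bool) : List Bool → List Bool := prodFn ∘ fanoutFn f g

/-- Value of `baddFn`. [folklore] -/
@[simp] theorem baddFn_apply (f g : List Bool → List Bool) (w : List Bool) :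
    baddFn f g w = encodeNat (Complexity.bitsToNat (f w) + Complexity.bitsToNat (g w)) := by
  simp [baddFn]

/-- Value of `bmulFn`. [folklore] -/
@[simp] theorem bmulFn_apply (f g : List Bool → List Bool) (w : List Bool) :
    bmulFn f g w = encodeNat (Complexity.bitsToNat (f w) * Complexity.bitsToNat (g w)) := by
  simp [bmulFn]

/-- `baddFn f g ∈ FP`. [folklore] -/
theorem baddFn_mem_FP {f g : List Bool → List Bool} (hf : f ∈ FP) (hg : g ∈ FP) : baddFn f g ∈ FP :=
  comp_mem_FP addFn_mem_FP (fanoutFn_mem_FP hf hg)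

/-- `bmulFn f g ∈ FP`. [folklore] -/
theorem bmulFn_mem_FP {f g : List Bool → List Bool} (hf : f ∈ FP) (hg : g ∈ FP) : bmulFn f g ∈ FP :=
  comp_mem_FP prodFn_mem_FP (fanoutFn_mem_FP hf hg)

/-- The constant binary numeral `encodeNat a`. [folklore] -/
def bconst (a : ℕ) : List Bool → List Bool := fun _ => encodeNat a

/-- Value of `bconst`. [folklore] -/
@[simp] theorem bconst_apply (a : ℕ) (w : List Bool) : bconst a w = encodeNat a := rfl

/-- `bconst a ∈ FP`. [folklore] -/
theorem bconst_mem_FP (a : ℕ) : bconst a ∈ FP := const_mem_FP _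

/-! ### The dimension, in unary -/

/-- **`nU inp = 1ⁿ`, `n = SIS.nOf inp`**: the length of the unary header of the payload (three
second projections, one first projection). [folklore] -/
def nU : List Bool → List Bool := onesFn ∘ fstP ∘ sndP ∘ sndP ∘ sndP

/-- `nU inp = 1^{nOf inp}` on every string. [folklore] -/
@[simp] theorem nU_apply (inp : List Bool) : nU inp = ones (nOf inp) := by
  simp [nU, onesFn, OracleCompose.unaryEncodeNat_eq_replicate, ones, nOf, payloadOf, fstP, sndP]

/-- `nU ∈ FP`. [folklore] -/
theorem nU_mem_FP : nU ∈ FP :=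
  comp_mem_FP onesFn_mem_FP (comp_mem_FP fstP_mem_FP (comp_mem_FP sndP_mem_FP (comp_mem_FP sndP_mem_FP sndP_mem_FP)))

/-! ### Parameters from a unary numeral `1ⁿ` (any string of length `n`) -/

/-- `llU w = 1^{logLen |w|}`: the length of the binary numeral of `|w| + 2`. [folklore] -/
def llU : List Bool → List Bool := onesFn ∘ lenBinF ∘ List.cons true ∘ List.cons true

/-- Value of `llU`. [folklore] -/
@[simp] theorem llU_apply (w : List Bool) : llU w = ones (logLen w.length) := by
  simp [llU, onesFn, OracleCompose.unaryEncodeNat_eq_replicate, ones, encodeNat_length_eq_size, size_add_two]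

/-- `llU ∈ FP`. [folklore] -/
theorem llU_mem_FP : llU ∈ FP :=
  comp_mem_FP onesFn_mem_FP (comp_mem_FP lenBinF_mem_FP (comp_mem_FP (cons_mem_FP true) (cons_mem_FP true)))

/-- `tU w = 1^{bitWidth |w|}`. [folklore] -/
def tU : List Bool → List Bool := polyFn (16 * X) ∘ llU

/-- Value of `tU`. [folklore] -/
@[simp] theorem tU_apply (w : List Bool) : tU w = ones (bitWidth w.length) := by
  simp [tU, bitWidth]

/-- `tU ∈ FP`. [folklore] -/
theorem tU_mem_FP : tU ∈ FP := comp_mem_FP (polyFn_mem_FP _) llU_mem_FP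

/-- `mU w = 1^{width |w|}` (`width n = 2 n · bitWidth n`). [folklore] -/
def mU : List Bool → List Bool := umulFn ∘ fanoutFn (polyFn (2 * X)) tU

/-- Value of `mU`. [folklore] -/
@[simp] theorem mU_apply (w : List Bool) : mU w = ones (width w.length) := by
  simp [mU, width]

/-- `mU ∈ FP`. [folklore] -/
theorem mU_mem_FP : mU ∈ FP := comp_mem_FP umulFn_mem_FP (fanoutFn_mem_FP (polyFn_mem_FP _) tU_mem_FP)

/-- `klU w = 1^{keyLen |w|}` (`keyLen n = n · width n · bitWidth n + width n`). [folklore] -/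
def klU : List Bool → List Bool :=
  concatFn ∘ fanoutFn (umulFn ∘ fanoutFn (umulFn ∘ fanoutFn onesFn mU) tU) mU

/-- Value of `klU`. [folklore] -/
@[simp] theorem klU_apply (w : List Bool) : klU w = ones (keyLen w.length) := by
  simp [klU, keyLen, onesFn, OracleCompose.unaryEncodeNat_eq_replicate, ones]

/-- `klU ∈ FP`. [folklore] -/
theorem klU_mem_FP : klU ∈ FP :=
  comp_mem_FP concatFn_mem_FP (fanoutFn_mem_FP
    (comp_mem_FP umulFn_mem_FP (fanoutFn_mem_FP (comp_mem_FP umulFn_mem_FP (fanoutFn_mem_FP onesFn_mem_FP mU_mem_FP)) tU_mem_FP))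
    mU_mem_FP)

/-- `klU' w = 1^{keyLen (|w| + 1)}`. [folklore] -/
def klU' : List Bool → List Bool := klU ∘ List.cons true

/-- Value of `klU'`. [folklore] -/
@[simp] theorem klU'_apply (w : List Bool) : klU' w = ones (keyLen (w.length + 1)) := by
  simp [klU']

/-- `klU' ∈ FP`. [folklore] -/
theorem klU'_mem_FP : klU' ∈ FP := comp_mem_FP klU_mem_FP (cons_mem_FP true)

/-- `blU w = 1^{blockLen |w|}` (`blockLen n = keyLen (n+1) - keyLen n`, a `drop`). [folklore] -/
def blU : List Bool → List Bool := dropFn ∘ fanoutFn klU klU'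

/-- Value of `blU`. [folklore] -/
@[simp] theorem blU_apply (w : List Bool) : blU w = ones (blockLen w.length) := by
  simp [blU, dropFn_boolPair, blockLen, ones, List.drop_replicate]

/-- `blU ∈ FP`. [folklore] -/
theorem blU_mem_FP : blU ∈ FP := comp_mem_FP dropFn_mem_FP (fanoutFn_mem_FP klU_mem_FP klU'_mem_FP)

/-- `gU w = 1^{guessBits |w|}` (`guessBits n = ⌊log₂ blockLen n⌋ + 1 = |encodeNat (blockLen n)|`). [folklore] -/
def gU : List Bool → List Bool := onesFn ∘ lenBinF ∘ blU

/-- Value of `gU`. [folklore] -/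
@[simp] theorem gU_apply (w : List Bool) : gU w = ones (guessBits w.length) := by
  have hb : blockLen w.length ≠ 0 := by have := one_le_blockLen w.length; omega
  simp [gU, onesFn, OracleCompose.unaryEncodeNat_eq_replicate, ones, guessBits, length_encodeNat_eq_log_succ hb]

/-- `gU ∈ FP`. [folklore] -/
theorem gU_mem_FP : gU ∈ FP := comp_mem_FP onesFn_mem_FP (comp_mem_FP lenBinF_mem_FP blU_mem_FP)

/-- The value of `SIS.modFn` (`SISFunctionProofs.lean`, stated there on unary numerals only) on
every string: `modFn w = encodeNat (modulus |w|) = 0^{bitWidth |w|} 1`. [folklore] -/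
@[simp] theorem modFn_eq_encodeNat_modulus (w : List Bool) : modFn w = encodeNat (modulus w.length) := by
  rw [modFn, size_add_two, modulus, bitWidth, encodeNat_two_pow_eq_replicate]

/-! ### The input bound and the coin-count guess, in binary -/

/-- `nB w = encodeNat |w|`. [folklore] -/
def nB : List Bool → List Bool := lenBinF

/-- `k1B w = encodeNat (keyLen (|w| + 1))`. [folklore] -/
def k1B : List Bool → List Bool := lenBinF ∘ klU'

/-- `resBoundB w = encodeNat (resBound |w| (modulus |w|))` (`resBound n q = 2n + 2 + n(2q + 2)`). [folklore] -/
def resBoundB : List Bool → List Bool :=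
  baddFn (baddFn (bmulFn (bconst 2) nB) (bconst 2)) (bmulFn nB (baddFn (bmulFn (bconst 2) modFn) (bconst 2)))

/-- The inner row bound `2m + 2 + m(2q + 2)` of `matBound`. [folklore] -/
def rowBoundB : List Bool → List Bool :=
  baddFn (baddFn (bmulFn (bconst 2) widthFn) (bconst 2)) (bmulFn widthFn (baddFn (bmulFn (bconst 2) modFn) (bconst 2)))

/-- `matBoundB w = encodeNat (matBound |w| (width |w|) (modulus |w|))`. [folklore] -/
def matBoundB : List Bool → List Bool :=
  baddFn (baddFn (bmulFn (bconst 2) nB) (bconst 2))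
    (baddFn (baddFn (bmulFn (bconst 2) widthFn) (bconst 2))
      (baddFn (baddFn (bmulFn (bconst 2) modFn) (bconst 2))
        (baddFn (baddFn (bmulFn (bconst 2) nB) (bconst 2))
          (bmulFn nB (baddFn (bmulFn (bconst 2) rowBoundB) (bconst 2))))))

/-- `inpBoundB w = encodeNat (inpBound |w|)`. [folklore] -/
def inpBoundB : List Bool → List Bool :=
  baddFn (baddFn (bmulFn (bconst 2) k1B) (bconst 2))
    (baddFn (baddFn (bmulFn (bconst 2) matBoundB) (bconst 2))
      (baddFn (baddFn (bmulFn (bconst 2) resBoundB) (bconst 2)) k1B))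

section
variable (w : List Bool)
/-- Value of `nB`. [folklore] -/
@[simp] theorem nB_apply : nB w = encodeNat w.length := lenBinF_apply w
/-- Value of `k1B`. [folklore] -/
@[simp] theorem k1B_apply : k1B w = encodeNat (keyLen (w.length + 1)) := by simp [k1B, ones]
/-- Value of `resBoundB`. [folklore] -/
@[simp] theorem resBoundB_apply : resBoundB w = encodeNat (resBound w.length (modulus w.length)) := by
  simp [resBoundB, resBound]
/-- Value of `rowBoundB`. [folklore] -/
@[simp] theorem rowBoundB_apply :
    rowBoundB w = encodeNat (2 * width w.length + 2 + width w.length * (2 * modulus w.length + 2)) := by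
  simp [rowBoundB, widthFn]
/-- Value of `matBoundB`. [folklore] -/
@[simp] theorem matBoundB_apply :
    matBoundB w = encodeNat (matBound w.length (width w.length) (modulus w.length)) := by
  simp [matBoundB, matBound, widthFn]
/-- Value of `inpBoundB`. [folklore] -/
@[simp] theorem inpBoundB_apply : inpBoundB w = encodeNat (inpBound w.length) := by
  simp [inpBoundB, inpBound]
end

/-- `nB ∈ FP`. [folklore] -/
theorem nB_mem_FP : nB ∈ FP := lenBinF_mem_FP
/-- `k1B ∈ FP`. [folklore] -/
theorem k1B_mem_FP : k1B ∈ FP := comp_mem_FP lenBinF_mem_FP klU'_mem_FP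
/-- `resBoundB ∈ FP`. [folklore] -/
theorem resBoundB_mem_FP : resBoundB ∈ FP :=
  baddFn_mem_FP (baddFn_mem_FP (bmulFn_mem_FP (bconst_mem_FP 2) nB_mem_FP) (bconst_mem_FP 2))
    (bmulFn_mem_FP nB_mem_FP (baddFn_mem_FP (bmulFn_mem_FP (bconst_mem_FP 2) modFn_mem_FP) (bconst_mem_FP 2)))
/-- `rowBoundB ∈ FP`. [folklore] -/
theorem rowBoundB_mem_FP : rowBoundB ∈ FP :=
  baddFn_mem_FP (baddFn_mem_FP (bmulFn_mem_FP (bconst_mem_FP 2) widthFn_mem_FP) (bconst_mem_FP 2))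
    (bmulFn_mem_FP widthFn_mem_FP (baddFn_mem_FP (bmulFn_mem_FP (bconst_mem_FP 2) modFn_mem_FP) (bconst_mem_FP 2)))
/-- `matBoundB ∈ FP`. [folklore] -/
theorem matBoundB_mem_FP : matBoundB ∈ FP :=
  baddFn_mem_FP (baddFn_mem_FP (bmulFn_mem_FP (bconst_mem_FP 2) nB_mem_FP) (bconst_mem_FP 2))
    (baddFn_mem_FP (baddFn_mem_FP (bmulFn_mem_FP (bconst_mem_FP 2) widthFn_mem_FP) (bconst_mem_FP 2))
      (baddFn_mem_FP (baddFn_mem_FP (bmulFn_mem_FP (bconst_mem_FP 2) modFn_mem_FP) (bconst_mem_FP 2))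
        (baddFn_mem_FP (baddFn_mem_FP (bmulFn_mem_FP (bconst_mem_FP 2) nB_mem_FP) (bconst_mem_FP 2))
          (bmulFn_mem_FP nB_mem_FP (baddFn_mem_FP (bmulFn_mem_FP (bconst_mem_FP 2) rowBoundB_mem_FP) (bconst_mem_FP 2))))))
/-- `inpBoundB ∈ FP`. [folklore] -/
theorem inpBoundB_mem_FP : inpBoundB ∈ FP :=
  baddFn_mem_FP (baddFn_mem_FP (bmulFn_mem_FP (bconst_mem_FP 2) k1B_mem_FP) (bconst_mem_FP 2))
    (baddFn_mem_FP (baddFn_mem_FP (bmulFn_mem_FP (bconst_mem_FP 2) matBoundB_mem_FP) (bconst_mem_FP 2))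
      (baddFn_mem_FP (baddFn_mem_FP (bmulFn_mem_FP (bconst_mem_FP 2) resBoundB_mem_FP) (bconst_mem_FP 2)) k1B_mem_FP))

/-- For a polynomial bound `cb = p`, the maximum over the block is the value at its end:
`cbMax (p ·) n = p (inpBound n)` (polynomials over `ℕ` are monotone). [folklore] -/
theorem cbMax_poly (p : Polynomial ℕ) (n : ℕ) : cbMax (fun ℓ => p.eval ℓ) n = p.eval (inpBound n) :=
  cbMax_eq_of_monotone (fun _ _ h => TM2Iter.eval_mono p h) n

/-- **`lbU p w = 1^{lenBits (p ·) |w|}`**: the number of coins of the coin-count guess,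
`lenBits cb n = ⌊log₂ (cbMax cb n + 1)⌋ + 1 = |encodeNat (p (inpBound n) + 1)|`. [folklore] -/
def lbU (p : Polynomial ℕ) : List Bool → List Bool := onesFn ∘ baddFn (bpolyFn p ∘ inpBoundB) (bconst 1)

/-- Value of `lbU`. [folklore] -/
@[simp] theorem lbU_apply (p : Polynomial ℕ) (w : List Bool) : lbU p w = ones (lenBits (fun ℓ => p.eval ℓ) w.length) := by
  simp [lbU, bpolyFn, onesFn, OracleCompose.unaryEncodeNat_eq_replicate, ones, lenBits, cbMax_poly,
    length_encodeNat_eq_log_succ (Nat.succ_ne_zero _)]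

/-- `lbU p ∈ FP`. [folklore] -/
theorem lbU_mem_FP (p : Polynomial ℕ) : lbU p ∈ FP :=
  comp_mem_FP onesFn_mem_FP (baddFn_mem_FP (comp_mem_FP (bpolyFn_mem_FP p) inpBoundB_mem_FP) (bconst_mem_FP 1))

end Literature.Computability.Cryptography.SIS.SolverFP

end
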